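import Summits.QuantumFields.YangMills.Theorems.ConvexGribovBodyBrascampLiebVacuumSCOnelinkHSHelpers

/-!
# Crux `BrascampLiebVacuumSC` (stmt-QuantumFields-16404), line `SketchIdeator1`: helpers for `stub_onelinkHS`, III

Configuration-level facts for the annealed one-link inequality: **measurability of the slope field**
`U ↦ slope_ℓ f U` (a parametric punctured `limsup` is an infimum over a countable neighbourhood basis of
suprema of lower semicontinuous functions, `onelink_measurable_limsup`; translate the punctured filter
to `1`), its bounds `0 ≤ slope ≤ K` and the fibre identity with the slope of the link function
`g ↦ f(U[ℓ ↦ g])` (`onelink_cslope_facts`); and **Holley–Stroock for the one-link heat-bath law**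
`ν_ℓ^U = Haar.tilted(−β S_W(U[ℓ ↦ ·]))`: the tilt oscillates by a volume-independent `Ω(β, r)` (only the
plaquettes in the shadow of `ℓ` see the link, `onelink_osc`), hence `e^{−Ω} ≤ dν/dHaar ≤ e^{Ω}`
(`onelink_density_bounds`, `onelink_integral_hbLaw_le`, `onelink_lintegral_haar_le`), and the conditional
variance is at most the mean-square deviation from any constant (`onelink_var_le`).

References: J. von Neumann, Math. Z. 30 (1929) 3–42; T. Bröcker, T. tom Dieck, *Representations of
Compact Lie Groups* (1985), I (3.11); R. Holley, D. Stroock, J. Stat. Phys. 46 (1987) 1159–1194;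
F. Martinelli, *Lectures on Glauber dynamics for discrete spin models*, LNM 1717 (1999), §2.3.
-/

open scoped BigOperators Topology Matrix ENNReal
open Filter MeasureTheory ProbabilityTheory
open Literature.MathematicalPhysics.QuantumFieldTheory
open Literature.RepresentationTheory.CompactGroups
open Summit.QuantumFields.YangMills.Cruxes.CovarianceBound.SupportWindow
  (froSq coulombF IsCoulMin gluon modeCov supCov wilson4)
open Summit.QuantumFields.YangMills.Theorems.PoincareClustering (hbLaw hbOp)

noncomputable section

namespace Summit.QuantumFields.YangMills.Theorems.BrascampLiebVacuumSC

/-! ### Measurability of metric slopes -/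

section Measurability

variable {G : Type} [Group G] [TopologicalSpace G]

/-- **A parametric punctured `limsup` is measurable**: if `x ↦ F x k` is lower semicontinuous for every
`k ≠ 1`, then `x ↦ limsup_{k → 1, k ≠ 1} F x k` is Borel measurable (an infimum over a countable
neighbourhood basis of suprema of lower semicontinuous functions). [folklore] -/
theorem onelink_measurable_limsup [(𝓝 (1 : G)).IsCountablyGenerated] {X : Type*}
    [TopologicalSpace X]
    [MeasurableSpace X] [OpensMeasurableSpace X] (F : X → G → ℝ≥0∞)
    (hF : ∀ k : G, k ≠ 1 → LowerSemicontinuous fun x => F x k) :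
    Measurable fun x => limsup (F x) (𝓝[≠] (1 : G)) := by
  obtain ⟨V, hV⟩ := (𝓝 (1 : G)).exists_antitone_basis
  have hB : (𝓝[≠] (1 : G)).HasBasis (fun _ => True) fun n => V n ∩ {1}ᶜ :=
    nhdsWithin_hasBasis hV.toHasBasis _
  have hrepr : (fun x => limsup (F x) (𝓝[≠] (1 : G))) =
      fun x => ⨅ n : ℕ, ⨆ k ∈ V n ∩ {1}ᶜ, F x k := by
    funext x
    rw [hB.limsup_eq_iInf_iSup]
    simp only [iInf_const]
  rw [hrepr]
  refine Measurable.iInf fun n => ?_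
  exact (lowerSemicontinuous_biSup fun k hk => hF k hk.2).measurable

end Measurability

/-! ### The link function `g ↦ f(U[ℓ ↦ g])` and the configuration-level slope -/

section Config

variable {G : Type} [Group G] [TopologicalSpace G] (r : LatticeRep G) {S : ℕ}

/-- A link-Lipschitz `f` has `K`-Lipschitz link functions (only the link `ℓ` differs). [folklore] -/
theorem onelink_lip_link {f : GaugeConfig 4 (2 * S + 1) G → ℝ} {K : ℝ}
    (hf : ∀ U V : GaugeConfig 4 (2 * S + 1) G,
      |f U - f V| ≤ K * ∑ e, Real.sqrt (froSq (r.ρ (U e) - r.ρ (V e))))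
    (ℓ : Edge 4 (2 * S + 1)) (U : GaugeConfig 4 (2 * S + 1) G) (g h : G) :
    |f (Function.update U ℓ g) - f (Function.update U ℓ h)| ≤ K * frobNorm (r.ρ g - r.ρ h) := by
  have key : ∑ e, Real.sqrt (froSq (r.ρ (Function.update U ℓ g e) - r.ρ (Function.update U ℓ h
      e))) =
      frobNorm (r.ρ g - r.ρ h) := by
    rw [Finset.sum_eq_single ℓ]
    · simp only [Function.update_self, onelink_sqrt_froSq]
    · intro e _ hne
      rw [Function.update_of_ne hne, Function.update_of_ne hne, sub_self, onelink_sqrt_froSq,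
          frobNorm_zero]
    · intro h; exact absurd (Finset.mem_univ ℓ) h
  have := hf (Function.update U ℓ g) (Function.update U ℓ h)
  rwa [key] at this

/-- A link-Lipschitz `f` is continuous on the configuration space. [folklore] -/
theorem onelink_continuous_cfg {f : GaugeConfig 4 (2 * S + 1) G → ℝ} {K : ℝ}
    (hf : ∀ U V : GaugeConfig 4 (2 * S + 1) G,
      |f U - f V| ≤ K * ∑ e, Real.sqrt (froSq (r.ρ (U e) - r.ρ (V e)))) : Continuous f := by
  -- adapted from `sliceRestr_continuous` (stub_sliceRestriction of the same line)
  have hD : ∀ V : GaugeConfig 4 (2 * S + 1) G, Continuous fun U : GaugeConfig 4 (2 * S + 1) G =>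
      ∑ e, Real.sqrt (froSq (r.ρ (U e) - r.ρ (V e))) := fun V => by
    refine continuous_finsetSum _ fun e _ => ?_
    rw [show (fun U : GaugeConfig 4 (2 * S + 1) G => Real.sqrt (froSq (r.ρ (U e) - r.ρ (V e)))) =
      fun U => frobNorm (r.ρ (U e) - r.ρ (V e)) from rfl]
    exact (onelink_continuous_frobNorm_sub r (V e)).comp (continuous_apply e)
  have hD0 : ∀ V : GaugeConfig 4 (2 * S + 1) G,
      (∑ e, Real.sqrt (froSq (r.ρ (V e) - r.ρ (V e)))) = 0 := fun V => by
    refine Finset.sum_eq_zero fun e _ => ?_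
    rw [sub_self, onelink_sqrt_froSq, frobNorm_zero]
  refine continuous_iff_continuousAt.2 fun V => ?_
  rw [ContinuousAt, tendsto_iff_norm_sub_tendsto_zero]
  refine squeeze_zero (fun U => norm_nonneg _)
    (fun U => (Real.norm_eq_abs _).le.trans (hf U V)) ?_
  exact (continuous_const.fun_mul (hD V)).tendsto' V 0 (by simp only [hD0 V, mul_zero])

/-- Under connectedness and non-triviality, punctured neighbourhood filters of `G` are non-trivial
(`G` is Hausdorff by faithfulness). [folklore] -/
theorem onelink_neBot (r : LatticeRep G) [ConnectedSpace G] [Nontrivial G] (x : G) :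
    (𝓝[≠] x).NeBot := by
  haveI : T2Space G := T2Space.of_injective_continuous r.injective r.continuous
  exact ConnectedSpace.neBot_nhdsWithin_compl_of_nontrivial_of_t1space x

variable [IsTopologicalGroup G] [MeasurableSpace G] [BorelSpace G] [SecondCountableTopology G]

/-- **Measurability of the slope field** (extended-real form): `U ↦ limsup_{g → U ℓ} |f(U[ℓ ↦ g]) − f U| /
‖ρ g − ρ(U ℓ)‖_F` is measurable for a link-Lipschitz `f` (translate the punctured filter to `1` and apply
`onelink_measurable_limsup`; for `k ≠ 1` the translated quotient is continuous in `U`). [folklore] -/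
theorem onelink_measurable_eslope {f : GaugeConfig 4 (2 * S + 1) G → ℝ} {K : ℝ}
    (hf : ∀ U V : GaugeConfig 4 (2 * S + 1) G,
      |f U - f V| ≤ K * ∑ e, Real.sqrt (froSq (r.ρ (U e) - r.ρ (V e)))) (ℓ : Edge 4 (2 * S + 1)) :
    Measurable fun U : GaugeConfig 4 (2 * S + 1) G => limsup (fun g : G => ENNReal.ofReal
      (|f (Function.update U ℓ g) - f U| / Real.sqrt (froSq (r.ρ g - r.ρ (U ℓ))))) (𝓝[≠] (U ℓ))
          := by
  have hfc : Continuous f := onelink_continuous_cfg r hf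
  set F : GaugeConfig 4 (2 * S + 1) G → G → ℝ≥0∞ := fun U k =>
    ENNReal.ofReal (|f (Function.update U ℓ (U ℓ * k)) - f U| / frobNorm (r.ρ k - r.ρ 1)) with
        hF_def
  have hrepr : (fun U : GaugeConfig 4 (2 * S + 1) G => limsup (fun g : G => ENNReal.ofReal
      (|f (Function.update U ℓ g) - f U| / Real.sqrt (froSq (r.ρ g - r.ρ (U ℓ))))) (𝓝[≠] (U ℓ))) =
      fun U => limsup (F U) (𝓝[≠] (1 : G)) := by
    funext U
    have hmap : map (fun k : G => U ℓ * k) (𝓝[≠] (1 : G)) = 𝓝[≠] (U ℓ) := by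
      have h := (Homeomorph.mulLeft (U ℓ)).map_punctured_nhds_eq (1 : G)
      simpa only [Homeomorph.coe_mulLeft, mul_one] using h
    rw [← hmap, ← limsup_comp]
    congr 1
    funext k
    simp only [Function.comp_apply, hF_def, onelink_sqrt_froSq]
    congr 2
    conv_lhs => rw [← mul_one (U ℓ), mul_assoc, one_mul]
    exact onelink_frobNorm_mul_left r (U ℓ) k 1
  rw [hrepr]
  refine onelink_measurable_limsup F fun k _ => Continuous.lowerSemicontinuous ?_
  simp only [hF_def]
  refine ENNReal.continuous_ofReal.comp ?_
  refine Continuous.div_const ?_ _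
  refine ((hfc.comp ?_).sub hfc).abs
  exact continuous_id.update ℓ ((continuous_apply ℓ).mul continuous_const)

/-- **The slope field is measurable, non-negative and bounded by the Lipschitz constant**, and along each
fibre it is the metric slope of the link function `g ↦ f(U[ℓ ↦ g])`: the four facts the annealing step
consumes. [folklore] -/
theorem onelink_cslope_facts [ConnectedSpace G] [Nontrivial G] {f : GaugeConfig 4 (2 * S + 1) G → ℝ}
    {K : ℝ} (hK : 0 ≤ K)
    (hf : ∀ U V : GaugeConfig 4 (2 * S + 1) G,
      |f U - f V| ≤ K * ∑ e, Real.sqrt (froSq (r.ρ (U e) - r.ρ (V e)))) (ℓ : Edge 4 (2 * S + 1)) :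
    (Measurable fun U : GaugeConfig 4 (2 * S + 1) G => (limsup (fun g => |f (Function.update U ℓ
        g) - f U| / Real.sqrt (froSq (r.ρ g - r.ρ (U ℓ)))) (𝓝[≠] (U ℓ)))) ∧
      (∀ U : GaugeConfig 4 (2 * S + 1) G, 0 ≤ (limsup (fun g => |f (Function.update U ℓ g) - f U|
          / Real.sqrt (froSq (r.ρ g - r.ρ (U ℓ)))) (𝓝[≠] (U ℓ)))) ∧
      (∀ U : GaugeConfig 4 (2 * S + 1) G, (limsup (fun g => |f (Function.update U ℓ g) - f U| /
          Real.sqrt (froSq (r.ρ g - r.ρ (U ℓ)))) (𝓝[≠] (U ℓ))) ≤ K) ∧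
      ∀ (U : GaugeConfig 4 (2 * S + 1) G) (g : G),
        limsup (fun h : G => ENNReal.ofReal (|f (Function.update U ℓ h) - f (Function.update U ℓ
            g)| /
          Real.sqrt (froSq (r.ρ h - r.ρ g)))) (𝓝[≠] g) =
          ENNReal.ofReal (limsup (fun g' => |f (Function.update (Function.update U ℓ g) ℓ g') - f
              (Function.update U ℓ g)| / Real.sqrt (froSq (r.ρ g' - r.ρ ((Function.update U ℓ g)
              ℓ)))) (𝓝[≠] ((Function.update U ℓ g) ℓ))) := by
  have hlip : ∀ U : GaugeConfig 4 (2 * S + 1) G, ∀ g h : G,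
      |f (Function.update U ℓ g) - f (Function.update U ℓ h)| ≤ K * frobNorm (r.ρ g - r.ρ h) :=
    fun U => onelink_lip_link r hf ℓ U
  have hreal : ∀ U : GaugeConfig 4 (2 * S + 1) G, (limsup (fun g => |f (Function.update U ℓ g) -
      f U| / Real.sqrt (froSq (r.ρ g - r.ρ (U ℓ)))) (𝓝[≠] (U ℓ))) =
      (limsup (fun g : G => ENNReal.ofReal (|f (Function.update U ℓ g) - f U| /
        Real.sqrt (froSq (r.ρ g - r.ρ (U ℓ))))) (𝓝[≠] (U ℓ))).toReal := fun U => by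
    haveI := onelink_neBot r (U ℓ)
    have h := limsup_dq_eq_toReal r hK (hlip U) (U ℓ)
    simp only [Function.update_eq_self] at h
    exact h
  have hle : ∀ U : GaugeConfig 4 (2 * S + 1) G,
      limsup (fun g : G => ENNReal.ofReal (|f (Function.update U ℓ g) - f U| /
        Real.sqrt (froSq (r.ρ g - r.ρ (U ℓ))))) (𝓝[≠] (U ℓ)) ≤ ENNReal.ofReal K := fun U => by
    have h := eslope_le r hK (hlip U) (U ℓ)
    simp only [Function.update_eq_self] at h
    exact h
  refine ⟨?_, fun U => ?_, fun U => ?_, fun U g => ?_⟩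
  · rw [show (fun U : GaugeConfig 4 (2 * S + 1) G => (limsup (fun g => |f (Function.update U ℓ g)
      - f U| / Real.sqrt (froSq (r.ρ g - r.ρ (U ℓ)))) (𝓝[≠] (U ℓ)))) = fun U =>
        (limsup (fun g : G => ENNReal.ofReal (|f (Function.update U ℓ g) - f U| /
          Real.sqrt (froSq (r.ρ g - r.ρ (U ℓ))))) (𝓝[≠] (U ℓ))).toReal from funext hreal]
    exact (onelink_measurable_eslope r hf ℓ).ennreal_toReal
  · rw [hreal]; exact ENNReal.toReal_nonneg
  · rw [hreal]
    exact ENNReal.toReal_le_of_le_ofReal hK (hle U)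
  · haveI := onelink_neBot r g
    simp only [Function.update_idem, Function.update_self]
    exact (ofReal_limsup_dq r hK (hlip U) g).symm

end Config

/-! ### Holley–Stroock for the one-link heat-bath law -/

section HeatBath

variable {G : Type} [Group G] [TopologicalSpace G] [IsTopologicalGroup G] [CompactSpace G]
  [MeasurableSpace G] [BorelSpace G] (r : LatticeRep G) (β : ℝ)

omit [IsTopologicalGroup G] [MeasurableSpace G] [BorelSpace G] in
/-- **Volume-independent oscillation of the one-link tilt**: along one link the Wilson energy
`−β S_W(U[ℓ ↦ g])` varies by at most `Ω(β, r)`, uniformly in the volume, the link and the background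
(only the `≤ 5·6` plaquettes based in the shadow of `ℓ` see the link; each costs `≤ N + M`). [folklore] -/
theorem onelink_osc : ∃ Ω : ℝ, 0 ≤ Ω ∧ ∀ (S : ℕ) (ℓ : Edge 4 (2 * S + 1))
    (U : GaugeConfig 4 (2 * S + 1) G) (g g' : G),
    -β * wilsonAction r.ρ (Function.update U ℓ g) - -β * wilsonAction r.ρ (Function.update U ℓ
        g') ≤ Ω := by
  obtain ⟨M, hM0, hM⟩ := exists_bound_trace_re_nonneg r.ρ r.continuous
  set A : ℝ := ((5 * Fintype.card {q : Fin 4 × Fin 4 // q.1 < q.2} : ℕ) : ℝ) * ((r.N : ℝ) + M)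
      with hA
  have hNM : 0 ≤ (r.N : ℝ) + M := by positivity
  have hA0 : 0 ≤ A := by positivity
  refine ⟨|β| * (A + A), by positivity, fun S ℓ U g g' => ?_⟩
  set B := edgeShadow ({ℓ} : Finset (Edge 4 (2 * S + 1))) with hB
  have hshadow : ∀ V : GaugeConfig 4 (2 * S + 1) G, |shadowAction r.ρ B V| ≤ A := fun V => by
    refine (abs_shadowAction_le r.ρ hM B V).trans ?_
    have hcard : B.card ≤ 5 := by
      have := card_edgeShadow_le ({ℓ} : Finset (Edge 4 (2 * S + 1)))
      rwa [Finset.card_singleton, one_mul] at this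
    rw [hA]
    refine mul_le_mul_of_nonneg_right ?_ hNM
    exact_mod_cast Nat.mul_le_mul_right _ hcard
  have hbulk : bulkAction r.ρ B (Function.update U ℓ g) = bulkAction r.ρ B (Function.update U ℓ
      g') :=
    bulkAction_congr r.ρ fun e he => by
      have hne : e ≠ ℓ := fun h => he (Finset.mem_singleton.2 h)
      rw [Function.update_of_ne hne, Function.update_of_ne hne]
  rw [wilsonAction_eq_shadowAction_add_bulkAction r.ρ B (Function.update U ℓ g),
    wilsonAction_eq_shadowAction_add_bulkAction r.ρ B (Function.update U ℓ g'), hbulk]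
  have h1 := hshadow (Function.update U ℓ g)
  have h2 := hshadow (Function.update U ℓ g')
  calc -β * (shadowAction r.ρ B (Function.update U ℓ g) + bulkAction r.ρ B (Function.update U ℓ
      g')) -
        -β * (shadowAction r.ρ B (Function.update U ℓ g') + bulkAction r.ρ B (Function.update U ℓ
            g'))
      = -β * (shadowAction r.ρ B (Function.update U ℓ g) - shadowAction r.ρ B (Function.update U
          ℓ g')) := by
        ring
    _ ≤ |-β * (shadowAction r.ρ B (Function.update U ℓ g) - shadowAction r.ρ B (Function.update U
        ℓ g'))| :=
        le_abs_self _
    _ = |β| * |shadowAction r.ρ B (Function.update U ℓ g) - shadowAction r.ρ B (Function.update U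
        ℓ g')| := by
        rw [abs_mul, abs_neg]
    _ ≤ |β| * (A + A) :=
        mul_le_mul_of_nonneg_left ((abs_sub _ _).trans (add_le_add h1 h2)) (abs_nonneg β)

variable [SecondCountableTopology G] {S : ℕ}

/-- **Two-sided density bounds** for the heat-bath law `ν_ℓ^U = Haar.tilted(T)`, `T = −β S_W(U[ℓ ↦ ·])`:
`e^{-Ω} ≤ e^{T}/Z ≤ e^{Ω}` when `T` oscillates by at most `Ω`. [folklore] -/
theorem onelink_density_bounds (ℓ : Edge 4 (2 * S + 1)) (U : GaugeConfig 4 (2 * S + 1) G) {Ω : ℝ}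
    (hΩ : ∀ g g' : G, -β * wilsonAction r.ρ (Function.update U ℓ g) -
      -β * wilsonAction r.ρ (Function.update U ℓ g') ≤ Ω) (g : G) :
    Real.exp (-β * wilsonAction r.ρ (Function.update U ℓ g)) /
        (∫ x, Real.exp (-β * wilsonAction r.ρ (Function.update U ℓ x)) ∂haarProbability G) ≤
            Real.exp Ω ∧
      Real.exp (-Ω) ≤ Real.exp (-β * wilsonAction r.ρ (Function.update U ℓ g)) /
        (∫ x, Real.exp (-β * wilsonAction r.ρ (Function.update U ℓ x)) ∂haarProbability G) := by
  set T : G → ℝ := fun x => -β * wilsonAction r.ρ (Function.update U ℓ x) with hT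
  have hint : Integrable (fun x => Real.exp (T x)) (haarProbability G) :=
    PoincareClustering.integrable_exp_tilt r.ρ β r.continuous ℓ U
  have hZpos : 0 < ∫ x, Real.exp (T x) ∂haarProbability G := integral_exp_pos hint
  have hlow : Real.exp (T g - Ω) ≤ ∫ x, Real.exp (T x) ∂haarProbability G := by
    have h := integral_mono (integrable_const (Real.exp (T g - Ω))) hint
      (fun x => Real.exp_le_exp.2 (by have := hΩ g x; simp only [hT]; linarith))
    rwa [integral_const, probReal_univ, one_smul] at h
  have hup : ∫ x, Real.exp (T x) ∂haarProbability G ≤ Real.exp (T g + Ω) := by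
    have h := integral_mono hint (integrable_const (Real.exp (T g + Ω)))
      (fun x => Real.exp_le_exp.2 (by have := hΩ x g; simp only [hT]; linarith))
    rwa [integral_const, probReal_univ, one_smul] at h
  change Real.exp (T g) / (∫ x, Real.exp (T x) ∂haarProbability G) ≤ Real.exp Ω ∧
    Real.exp (-Ω) ≤ Real.exp (T g) / (∫ x, Real.exp (T x) ∂haarProbability G)
  constructor
  · rw [div_le_iff₀ hZpos]
    calc Real.exp (T g) = Real.exp Ω * Real.exp (T g - Ω) := by rw [← Real.exp_add]; ring_nf
      _ ≤ Real.exp Ω * ∫ x, Real.exp (T x) ∂haarProbability G :=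
          mul_le_mul_of_nonneg_left hlow (Real.exp_pos Ω).le
  · rw [le_div_iff₀ hZpos]
    calc Real.exp (-Ω) * ∫ x, Real.exp (T x) ∂haarProbability G ≤ Real.exp (-Ω) * Real.exp (T g +
        Ω) :=
          mul_le_mul_of_nonneg_left hup (Real.exp_pos _).le
      _ = Real.exp (T g) := by rw [← Real.exp_add]; ring_nf

/-- **Heat bath ≤ e^Ω · Haar** on non-negative bounded measurable functions. [folklore] -/
theorem onelink_integral_hbLaw_le (ℓ : Edge 4 (2 * S + 1)) (U : GaugeConfig 4 (2 * S + 1) G) {Ω : ℝ}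
    (hΩ : ∀ g g' : G, -β * wilsonAction r.ρ (Function.update U ℓ g) -
      -β * wilsonAction r.ρ (Function.update U ℓ g') ≤ Ω)
    {φ : G → ℝ} (hφm : Measurable φ) {B : ℝ} (hφb : ∀ g, |φ g| ≤ B) (hφ0 : ∀ g, 0 ≤ φ g) :
    ∫ g, φ g ∂(hbLaw r.ρ β ℓ U) ≤ Real.exp Ω * ∫ g, φ g ∂haarProbability G := by
  have hd := onelink_density_bounds r β ℓ U hΩ
  have hTm : Measurable fun x : G => -β * wilsonAction r.ρ (Function.update U ℓ x) := by
    have h := (PoincareClustering.measurable_tilt (d := 4) (L := 2 * S + 1) r.ρ β r.continuous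
        ℓ).comp
      (measurable_prodMk_left (x := U))
    exact h
  have hφi : Integrable φ (haarProbability G) := integrable_of_measurable_of_abs_le hφm hφb
  rw [hbLaw, integral_tilted, ← integral_const_mul]
  simp_rw [smul_eq_mul]
  refine integral_mono ?_ (hφi.const_mul _) fun x => mul_le_mul_of_nonneg_right (hd x).1 (hφ0 x)
  refine integrable_of_measurable_of_abs_le ((hTm.exp.div_const _).mul hφm) (C := Real.exp Ω * B)
    fun x => ?_
  rw [abs_mul, abs_of_nonneg (div_nonneg (Real.exp_pos _).le (integral_nonneg fun y =>
      (Real.exp_pos _).le))]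
  exact mul_le_mul (hd x).1 (hφb x) (abs_nonneg _) (Real.exp_pos Ω).le

/-- **Haar ≤ e^Ω · heat bath** on `ℝ≥0∞`-valued functions. [folklore] -/
theorem onelink_lintegral_haar_le (ℓ : Edge 4 (2 * S + 1)) (U : GaugeConfig 4 (2 * S + 1) G) {Ω : ℝ}
    (hΩ : ∀ g g' : G, -β * wilsonAction r.ρ (Function.update U ℓ g) -
      -β * wilsonAction r.ρ (Function.update U ℓ g') ≤ Ω) (F : G → ℝ≥0∞) :
    ∫⁻ g, F g ∂haarProbability G ≤ ENNReal.ofReal (Real.exp Ω) * ∫⁻ g, F g ∂(hbLaw r.ρ β ℓ U) := by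
  have hd := onelink_density_bounds r β ℓ U hΩ
  rw [hbLaw, lintegral_tilted]
  calc ∫⁻ g, F g ∂haarProbability G
      = ENNReal.ofReal (Real.exp Ω) * (ENNReal.ofReal (Real.exp (-Ω)) * ∫⁻ g, F g
          ∂haarProbability G) := by
        rw [← mul_assoc, ← ENNReal.ofReal_mul (Real.exp_pos Ω).le, ← Real.exp_add, add_neg_cancel,
          Real.exp_zero, ENNReal.ofReal_one, one_mul]
    _ = ENNReal.ofReal (Real.exp Ω) * ∫⁻ g, ENNReal.ofReal (Real.exp (-Ω)) * F g ∂haarProbability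
        G := by
        rw [lintegral_const_mul' _ _ ENNReal.ofReal_ne_top]
    _ ≤ ENNReal.ofReal (Real.exp Ω) * ∫⁻ g, ENNReal.ofReal (Real.exp (-β * wilsonAction r.ρ
          (Function.update U ℓ g)) / ∫ x, Real.exp (-β * wilsonAction r.ρ (Function.update U ℓ x))
            ∂haarProbability G) * F g ∂haarProbability G := by
        gcongr with g
        exact (hd g).2

/-- The conditional variance is at most the mean-square deviation from any constant:
`E_ℓ(f²)(U) − (E_ℓ f (U))² ≤ ∫ (f(U[ℓ ↦ g]) − c)² dν_ℓ^U(g)`. [folklore] -/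
theorem onelink_var_le (ℓ : Edge 4 (2 * S + 1)) (U : GaugeConfig 4 (2 * S + 1) G)
    {f : GaugeConfig 4 (2 * S + 1) G → ℝ} (hfm : Measurable f) {Mf : ℝ} (hMf : ∀ V, |f V| ≤ Mf)
        (c : ℝ) :
    hbOp r.ρ β ℓ (fun V => f V ^ 2) U - (hbOp r.ρ β ℓ f U) ^ 2 ≤
      ∫ g, (f (Function.update U ℓ g) - c) ^ 2 ∂(hbLaw r.ρ β ℓ U) := by
  haveI := PoincareClustering.isProbabilityMeasure_hbLaw r.ρ β r.continuous ℓ U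
  have h1 : Integrable (fun g => f (Function.update U ℓ g)) (hbLaw r.ρ β ℓ U) :=
    PoincareClustering.integrable_comp_update r.ρ β r.continuous ℓ U hfm hMf
  have h2 : Integrable (fun g => f (Function.update U ℓ g) ^ 2) (hbLaw r.ρ β ℓ U) :=
    PoincareClustering.integrable_comp_update r.ρ β r.continuous ℓ U (h := fun V => f V ^ 2)
      (hfm.pow_const 2) (fun V => by rw [abs_pow]; exact pow_le_pow_left₀ (abs_nonneg _) (hMf V) 2)
  have hexp : ∀ g, (f (Function.update U ℓ g) - c) ^ 2 =
      f (Function.update U ℓ g) ^ 2 - 2 * c * f (Function.update U ℓ g) + c ^ 2 := fun g => by ring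
  have h3 : Integrable (fun g => 2 * c * f (Function.update U ℓ g)) (hbLaw r.ρ β ℓ U) :=
      h1.const_mul _
  have h4 : Integrable (fun g => f (Function.update U ℓ g) ^ 2 - 2 * c * f (Function.update U ℓ g))
      (hbLaw r.ρ β ℓ U) := h2.sub h3
  simp_rw [hexp]
  rw [integral_add h4 (integrable_const _), integral_sub h2 h3, integral_const_mul, integral_const,
    probReal_univ, one_smul]
  simp only [hbOp]
  nlinarith [sq_nonneg (∫ g, f (Function.update U ℓ g) ∂(hbLaw r.ρ β ℓ U) - c)]

/-- **Registered sub-goal of `stub_onelinkHS` (volume-free oscillation of the one-link tilt, closed form of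
`onelink_osc`).** For every `β` there is `Ω(β, r) ≥ 0` such that on every torus, for every link `ℓ`, background
`U` and `g, g' ∈ G`: `−β S_W(U[ℓ ↦ g]) + β S_W(U[ℓ ↦ g']) ≤ Ω` (only the shadow plaquettes of `ℓ` see the
link). [folklore] -/
theorem stub_onelinkHS_heatBath :
    ∀ (G : Type) [Group G] [TopologicalSpace G] [IsTopologicalGroup G] [CompactSpace G]
    [MeasurableSpace G] [BorelSpace G] (r : LatticeRep G) (β : ℝ), ∃ Ω : ℝ, 0 ≤ Ω ∧
      ∀ (S : ℕ) (ℓ : Edge 4 (2 * S + 1)) (U : GaugeConfig 4 (2 * S + 1) G) (g g' : G),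
        -β * wilsonAction r.ρ (Function.update U ℓ g) - -β * wilsonAction r.ρ (Function.update U ℓ g') ≤ Ω :=
  fun _ _ _ _ _ _ _ r β => onelink_osc r β

end HeatBath

end Summit.QuantumFields.YangMills.Theorems.BrascampLiebVacuumSC

end
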